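import Summits.CriticalPhenomena.PercolationContinuityZ3.Theorems.Transplant.FKConnectivityAllQPat3MinorSteps
import Summits.CriticalPhenomena.PercolationContinuityZ3.Theorems.Transplant.FKConnectivityAllQPat3SPRecursion
import HarnessLib

/-!
# Connectivity correlation inequalities for `φ_{w,q}`, every `q > 0` — THEOREM SP on MINORS: the structural recursion (type I, one marked terminal)

Proof file (`--supports stmt-CriticalPhenomena-4575`), census lineage (gen 37) of LANE 2's FK sub-programme; builds on p205010
(kernel theorem, internal audit signed; external expert review pending).  No definitions, no named facts, no sorries.

Census g37's re-rooting recursion (`…Pat3SPRecursion.lean`) with a MINOR `(E, C)` of the network riding along UNCHANGED: the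
recursion is on the two-terminal series–parallel structure of the ambient network (re-rooting lemmas `FK.reroot_serA/serB/par`
reused verbatim), the free / contracted sets are only restricted to the pieces at the leaves (`FK.inter_union2_eq`,
`FK.inter_union3_eq`), where census g37's minor leaves (`…Pat3MinorSteps.lean`) apply.  `FK.typeIC_good`, `FK.pbC_good`.
[cite: AyyerLinussonRavichandran2025, §7 (p. 22)] [cite: Grimmett2006, §3.8 (pp. 61–62)]
-/

namespace Summit.CriticalPhenomena.PercolationContinuityZ3.Theorems

namespace FK

open SimpleGraph Literature.Probability.LatticeModels Literature.Probability.Percolation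
open scoped Classical

variable {V : Type*}

section Split

/-- Restricting a subset of a union of two pieces to the pieces. [folklore] -/
theorem inter_union2_eq {E S A B : Finset (Sym2 V)} (hE : E ⊆ S) (hS : S = A ∪ B) : E ∩ A ∪ E ∩ B = E := by
  rw [← Finset.inter_union_distrib_left, ← hS, Finset.inter_eq_left.2 hE]

/-- Restricting a subset of a union of three pieces to the pieces. [folklore] -/
theorem inter_union3_eq {E S A B D : Finset (Sym2 V)} (hE : E ⊆ S) (hS : S = A ∪ B ∪ D) :
    E ∩ A ∪ E ∩ B ∪ E ∩ D = E := by
  rw [← Finset.inter_union_distrib_left, ← Finset.inter_union_distrib_left, ← hS, Finset.inter_eq_left.2 hE]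

end Split

/-! ### Type I on minors -/

section TypeIC

variable [Fintype V] {F₁ F₂ E₂ : Finset (Sym2 V)} {x m y : V} {E C : Finset (Sym2 V)}

/-- Type I on minors, series case with a mark at the junction `m`: CORNER after re-rooting. [cite: AyyerLinussonRavichandran2025, §7 (p. 22)] -/
theorem typeIC_junction {b t : V} (h₂ : IsTTSP E₂ x y) (hd : Disjoint (F₁ ∪ F₂) E₂)
    (hV : ∀ z : V, (∃ e ∈ F₁ ∪ F₂, z ∈ e) → (∃ e ∈ E₂, z ∈ e) → z = x ∨ z = y)
    (hF₁ : IsTTSP F₁ x m) (hF₂ : IsTTSP F₂ m y) (hdF : Disjoint F₁ F₂)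
    (hVF : ∀ z : V, (∃ e ∈ F₁, z ∈ e) → (∃ e ∈ F₂, z ∈ e) → z = m) (hxF₂ : ∀ e ∈ F₂, x ∉ e) (hyF₁ : ∀ e ∈ F₁, y ∉ e)
    (hE : E ⊆ F₁ ∪ F₂ ∪ E₂) (hC : C ⊆ F₁ ∪ F₂ ∪ E₂)
    (ht : ∃ e ∈ F₁ ∪ F₂, t ∈ e) (htm : t ≠ m) (htx : t ≠ x) (hty : t ≠ y)
    (hb : ∃ e ∈ E₂, b ∈ e) (hbx : b ≠ x) (hby : b ≠ y) : SPGoodC E C b m t := by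
  obtain ⟨eb, heb, hbeb⟩ := hb
  have hbm : b ≠ m := fun h => junction_not_mem hV hF₁ hF₂ eb heb (h ▸ hbeb)
  rcases span_union ht with ht1 | ht2
  · obtain ⟨hA, hdA, hVA⟩ := reroot_serA h₂ hd hV hF₁ hF₂ hdF hVF hxF₂ hyF₁
    have hS : F₁ ∪ F₂ ∪ E₂ = F₁ ∪ (F₂ ∪ E₂) := Finset.union_assoc _ _ _
    have hc := spGoodC_corner hdA hVA hF₁.symm hA (Finset.inter_subset_right (s₁ := E)) (Finset.inter_subset_right (s₁ := C))
      (Finset.inter_subset_right (s₁ := E)) (Finset.inter_subset_right (s₁ := C)) ht1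
      ⟨eb, Finset.mem_union_right _ heb, hbeb⟩ htm htx hbm hbx
    exact hc.rotate'.congr_sets (inter_union2_eq hE hS) (inter_union2_eq hC hS)
  · obtain ⟨hB, hdB, hVB⟩ := reroot_serB h₂ hd hV hF₁ hF₂ hdF hVF hxF₂ hyF₁
    have hS : F₁ ∪ F₂ ∪ E₂ = F₂ ∪ (F₁ ∪ E₂) := by ext e; simp only [Finset.mem_union]; tauto
    have hc := spGoodC_corner hdB hVB hF₂ hB (Finset.inter_subset_right (s₁ := E)) (Finset.inter_subset_right (s₁ := C))
      (Finset.inter_subset_right (s₁ := E)) (Finset.inter_subset_right (s₁ := C)) ht2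
      ⟨eb, Finset.mem_union_right _ heb, hbeb⟩ htm hty hbm hby
    exact hc.rotate'.congr_sets (inter_union2_eq hE hS) (inter_union2_eq hC hS)

/-- Type I on minors, series case with the two marks on different blocks: RING. [cite: AyyerLinussonRavichandran2025, §7 (p. 22)] -/
theorem typeIC_ring {b s t : V} (h₂ : IsTTSP E₂ x y) (hd : Disjoint (F₁ ∪ F₂) E₂)
    (hV : ∀ z : V, (∃ e ∈ F₁ ∪ F₂, z ∈ e) → (∃ e ∈ E₂, z ∈ e) → z = x ∨ z = y)
    (hF₁ : IsTTSP F₁ x m) (hF₂ : IsTTSP F₂ m y) (hdF : Disjoint F₁ F₂)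
    (hVF : ∀ z : V, (∃ e ∈ F₁, z ∈ e) → (∃ e ∈ F₂, z ∈ e) → z = m) (hxF₂ : ∀ e ∈ F₂, x ∉ e) (hyF₁ : ∀ e ∈ F₁, y ∉ e)
    (hE : E ⊆ F₁ ∪ F₂ ∪ E₂) (hC : C ⊆ F₁ ∪ F₂ ∪ E₂)
    (hs : ∃ e ∈ F₁, s ∈ e) (hsm : s ≠ m) (hsx : s ≠ x) (ht : ∃ e ∈ F₂, t ∈ e) (htm : t ≠ m) (hty : t ≠ y)
    (hb : ∃ e ∈ E₂, b ∈ e) (hbx : b ≠ x) (hby : b ≠ y) : SPGoodC E C b s t := by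
  have hd1 : Disjoint F₁ E₂ := (Finset.disjoint_union_left.1 hd).1
  have hd2 : Disjoint F₂ E₂ := (Finset.disjoint_union_left.1 hd).2
  have hVK1 : ∀ z : V, (∃ e ∈ E₂, z ∈ e) → (∃ e ∈ F₁, z ∈ e) → z = x := fun z hzE hz1 => by
    obtain ⟨f, hf, hzf⟩ := hz1
    rcases hV z ⟨f, Finset.mem_union_left _ hf, hzf⟩ hzE with h | h
    · exact h
    · exact absurd hzf (h ▸ hyF₁ f hf)
  have hVK2 : ∀ z : V, (∃ e ∈ E₂, z ∈ e) → (∃ e ∈ F₂, z ∈ e) → z = y := fun z hzE hz2 => by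
    obtain ⟨f, hf, hzf⟩ := hz2
    rcases hV z ⟨f, Finset.mem_union_right _ hf, hzf⟩ hzE with h | h
    · exact absurd hzf (h ▸ hxF₂ f hf)
    · exact h
  have hu2 : ¬ ∃ e ∈ F₂, x ∈ e := fun ⟨e, he, hxe⟩ => hxF₂ e he hxe
  have hv1 : ¬ ∃ e ∈ F₁, y ∈ e := fun ⟨e, he, hye⟩ => hyF₁ e he hye
  have hS : F₁ ∪ F₂ ∪ E₂ = E₂ ∪ F₁ ∪ F₂ := by ext e; simp only [Finset.mem_union]; tauto
  have hr := spGoodC_ring hd1.symm hd2.symm hdF hVK1 hVF hVK2 hu2 hv1 hF₁.ne hF₂.ne.symm h₂.symm hF₁ hF₂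
    (Finset.inter_subset_right (s₁ := E)) (Finset.inter_subset_right (s₁ := C)) (Finset.inter_subset_right (s₁ := E))
    (Finset.inter_subset_right (s₁ := C)) (Finset.inter_subset_right (s₁ := E)) (Finset.inter_subset_right (s₁ := C))
    hb hs ht hbx hby hsx hsm hty htm
  exact hr.congr_sets (inter_union3_eq hE hS) (inter_union3_eq hC hS)

/-- **THE TYPE-I RECURSION ON MINORS.** [cite: AyyerLinussonRavichandran2025, §7 (p. 22)] -/
theorem typeIC_good : ∀ (n : ℕ) {E₁ E₂ E C : Finset (Sym2 V)} {x y b s t : V}, E₁.card ≤ n →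
    IsTTSP E₁ x y → IsTTSP E₂ x y → Disjoint E₁ E₂ →
    (∀ z : V, (∃ e ∈ E₁, z ∈ e) → (∃ e ∈ E₂, z ∈ e) → z = x ∨ z = y) →
    E ⊆ E₁ ∪ E₂ → C ⊆ E₁ ∪ E₂ →
    (∃ e ∈ E₁, s ∈ e) → (∃ e ∈ E₁, t ∈ e) → (∃ e ∈ E₂, b ∈ e) →
    s ≠ x → s ≠ y → t ≠ x → t ≠ y → b ≠ x → b ≠ y → s ≠ t → SPGoodC E C b s t := by
  intro n
  induction n with
  | zero =>
    intro E₁ E₂ E C x y b s t hcard h₁ _ _ _ _ _ _ _ _ _ _ _ _ _ _ _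
    have := h₁.card_pos
    omega
  | succ n ih =>
    intro E₁ E₂ E C x y b s t hcard h₁ h₂ hd hV hE hC hs ht hb hsx hsy htx hty hbx hby hst
    cases h₁ with
    | edge hxy =>
      obtain ⟨e, he, hse⟩ := hs
      rw [Finset.mem_singleton] at he
      subst he
      rcases Sym2.mem_iff.1 hse with h | h
      · exact absurd h hsx
      · exact absurd h hsy
    | @parallel Q₁ Q₂ _ _ hQ₁ hQ₂ hdQ hVQ =>
      have hlt1 := card_left_lt_of_parallel hQ₂ hdQ
      have hlt2 := card_right_lt_of_parallel hQ₁ hdQ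
      have hd1 : Disjoint Q₁ E₂ := (Finset.disjoint_union_left.1 hd).1
      have hd2 : Disjoint Q₂ E₂ := (Finset.disjoint_union_left.1 hd).2
      have hVK1 : ∀ z : V, (∃ e ∈ E₂, z ∈ e) → (∃ e ∈ Q₁, z ∈ e) → z = x ∨ z = y := fun z hzE hz1 => by
        obtain ⟨f, hf, hzf⟩ := hz1
        exact hV z ⟨f, Finset.mem_union_left _ hf, hzf⟩ hzE
      have hVK2 : ∀ z : V, (∃ e ∈ E₂, z ∈ e) → (∃ e ∈ Q₂, z ∈ e) → z = x ∨ z = y := fun z hzE hz2 => by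
        obtain ⟨f, hf, hzf⟩ := hz2
        exact hV z ⟨f, Finset.mem_union_right _ hf, hzf⟩ hzE
      obtain ⟨eb, heb, hbeb⟩ := hb
      have eA : Q₁ ∪ Q₂ ∪ E₂ = Q₁ ∪ (Q₂ ∪ E₂) := Finset.union_assoc _ _ _
      have eB : Q₁ ∪ Q₂ ∪ E₂ = Q₂ ∪ (Q₁ ∪ E₂) := by ext e; simp only [Finset.mem_union]; tauto
      rcases span_union hs with hs1 | hs2 <;> rcases span_union ht with ht1 | ht2
      · obtain ⟨hP, hdP, hVP⟩ := reroot_par h₂ hd hV hQ₂ hdQ hVQ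
        exact ih (by omega) hQ₁ hP hdP hVP (eA ▸ hE) (eA ▸ hC) hs1 ht1 ⟨eb, Finset.mem_union_right _ heb, hbeb⟩ hsx hsy htx
          hty hbx hby hst
      · have hS : Q₁ ∪ Q₂ ∪ E₂ = E₂ ∪ Q₁ ∪ Q₂ := by ext e; simp only [Finset.mem_union]; tauto
        have hr := spGoodC_theta hd1.symm hd2.symm hdQ hVK1 hVK2 hVQ h₂ hQ₁ hQ₂ (Finset.inter_subset_right (s₁ := E))
          (Finset.inter_subset_right (s₁ := C)) (Finset.inter_subset_right (s₁ := E)) (Finset.inter_subset_right (s₁ := C))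
          (Finset.inter_subset_right (s₁ := E)) (Finset.inter_subset_right (s₁ := C)) ⟨eb, heb, hbeb⟩ hs1 ht2 hbx hby hsx
          hsy htx hty
        exact hr.congr_sets (inter_union3_eq hE hS) (inter_union3_eq hC hS)
      · have hS : Q₁ ∪ Q₂ ∪ E₂ = E₂ ∪ Q₂ ∪ Q₁ := by ext e; simp only [Finset.mem_union]; tauto
        have hr := spGoodC_theta hd2.symm hd1.symm hdQ.symm hVK2 hVK1 (fun z hz2 hz1 => hVQ z hz1 hz2) h₂ hQ₂ hQ₁
          (Finset.inter_subset_right (s₁ := E)) (Finset.inter_subset_right (s₁ := C)) (Finset.inter_subset_right (s₁ := E))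
          (Finset.inter_subset_right (s₁ := C)) (Finset.inter_subset_right (s₁ := E)) (Finset.inter_subset_right (s₁ := C))
          ⟨eb, heb, hbeb⟩ hs2 ht1 hbx hby hsx hsy htx hty
        exact hr.congr_sets (inter_union3_eq hE hS) (inter_union3_eq hC hS)
      · obtain ⟨hP, hdP, hVP⟩ := reroot_par' h₂ hd hV hQ₁ hdQ hVQ
        exact ih (by omega) hQ₂ hP hdP hVP (eB ▸ hE) (eB ▸ hC) hs2 ht2 ⟨eb, Finset.mem_union_right _ heb, hbeb⟩ hsx hsy htx
          hty hbx hby hst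
    | @series F₁ F₂ _ m _ hF₁ hF₂ hdF hVF hxF₂ hyF₁ =>
      have hlt1 := card_left_lt_of_parallel hF₂ hdF
      have hlt2 := card_right_lt_of_parallel hF₁ hdF
      by_cases hsm : s = m
      · subst hsm
        exact typeIC_junction h₂ hd hV hF₁ hF₂ hdF hVF hxF₂ hyF₁ hE hC ht (Ne.symm hst) htx hty hb hbx hby
      by_cases htm : t = m
      · subst htm
        exact (typeIC_junction h₂ hd hV hF₁ hF₂ hdF hVF hxF₂ hyF₁ hE hC hs hsm hsx hsy hb hbx hby).swap23
      obtain ⟨eb, heb, hbeb⟩ := hb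
      have hbm : b ≠ m := fun h => junction_not_mem hV hF₁ hF₂ eb heb (h ▸ hbeb)
      have eA : F₁ ∪ F₂ ∪ E₂ = F₁ ∪ (F₂ ∪ E₂) := Finset.union_assoc _ _ _
      have eB : F₁ ∪ F₂ ∪ E₂ = F₂ ∪ (F₁ ∪ E₂) := by ext e; simp only [Finset.mem_union]; tauto
      rcases span_union hs with hs1 | hs2 <;> rcases span_union ht with ht1 | ht2
      · obtain ⟨hA, hdA, hVA⟩ := reroot_serA h₂ hd hV hF₁ hF₂ hdF hVF hxF₂ hyF₁
        exact ih (by omega) hF₁.symm hA hdA hVA (eA ▸ hE) (eA ▸ hC) hs1 ht1 ⟨eb, Finset.mem_union_right _ heb, hbeb⟩ hsm hsx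
          htm htx hbm hbx hst
      · exact typeIC_ring h₂ hd hV hF₁ hF₂ hdF hVF hxF₂ hyF₁ hE hC hs1 hsm hsx ht2 htm hty ⟨eb, heb, hbeb⟩ hbx hby
      · exact (typeIC_ring h₂ hd hV hF₁ hF₂ hdF hVF hxF₂ hyF₁ hE hC ht1 htm htx hs2 hsm hsy ⟨eb, heb, hbeb⟩ hbx hby).swap23
      · obtain ⟨hB, hdB, hVB⟩ := reroot_serB h₂ hd hV hF₁ hF₂ hdF hVF hxF₂ hyF₁
        exact ih (by omega) hF₂ hB hdB hVB (eB ▸ hE) (eB ▸ hC) hs2 ht2 ⟨eb, Finset.mem_union_right _ heb, hbeb⟩ hsm hsy htm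
          hty hbm hby hst

end TypeIC

/-! ### One marked terminal, on minors -/

section OneTerminalC

variable [Fintype V] {F₁ F₂ E₂ : Finset (Sym2 V)} {x m y : V} {E C : Finset (Sym2 V)}

/-- One marked terminal on minors, series case with the junction marked: cut `{x, m}` = two marks (`FK.spGoodC_parTwo`).
[cite: AyyerLinussonRavichandran2025, §7 (p. 22)] -/
theorem pbC_junction {t : V} (h₂ : IsTTSP E₂ x y) (hd : Disjoint (F₁ ∪ F₂) E₂)
    (hV : ∀ z : V, (∃ e ∈ F₁ ∪ F₂, z ∈ e) → (∃ e ∈ E₂, z ∈ e) → z = x ∨ z = y)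
    (hF₁ : IsTTSP F₁ x m) (hF₂ : IsTTSP F₂ m y) (hdF : Disjoint F₁ F₂)
    (hVF : ∀ z : V, (∃ e ∈ F₁, z ∈ e) → (∃ e ∈ F₂, z ∈ e) → z = m) (hxF₂ : ∀ e ∈ F₂, x ∉ e) (hyF₁ : ∀ e ∈ F₁, y ∉ e)
    (hE : E ⊆ F₁ ∪ F₂ ∪ E₂) (hC : C ⊆ F₁ ∪ F₂ ∪ E₂)
    (ht : ∃ e ∈ F₁ ∪ F₂, t ∈ e) (htm : t ≠ m) (htx : t ≠ x) : SPGoodC E C x m t := by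
  obtain ⟨hA, hdA, hVA⟩ := reroot_serA h₂ hd hV hF₁ hF₂ hdF hVF hxF₂ hyF₁
  have hVA' : ∀ z : V, (∃ e ∈ F₁, z ∈ e) → (∃ e ∈ F₂ ∪ E₂, z ∈ e) → z = x ∨ z = m := fun z h1 h => (hVA z h1 h).symm
  rcases span_union ht with ht1 | ht2
  · have hS : F₁ ∪ F₂ ∪ E₂ = F₂ ∪ E₂ ∪ F₁ := by ext e; simp only [Finset.mem_union]; tauto
    have hr := spGoodC_parTwo hdA.symm (fun z h h1 => hVA' z h1 h) hF₁.ne hF₁ (Finset.inter_subset_right (s₁ := E))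
      (Finset.inter_subset_right (s₁ := C)) (Finset.inter_subset_right (s₁ := E)) (Finset.inter_subset_right (s₁ := C)) ht1 htx htm
    exact hr.congr_sets (inter_union2_eq hE hS) (inter_union2_eq hC hS)
  · have hS : F₁ ∪ F₂ ∪ E₂ = F₁ ∪ (F₂ ∪ E₂) := Finset.union_assoc _ _ _
    have hr := spGoodC_parTwo hdA hVA' hF₁.ne hA.symm (Finset.inter_subset_right (s₁ := E))
      (Finset.inter_subset_right (s₁ := C)) (Finset.inter_subset_right (s₁ := E)) (Finset.inter_subset_right (s₁ := C))
      ⟨ht2.choose, Finset.mem_union_left _ ht2.choose_spec.1, ht2.choose_spec.2⟩ htx htm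
    exact hr.congr_sets (inter_union2_eq hE hS) (inter_union2_eq hC hS)

/-- **ONE MARKED TERMINAL ON MINORS.** [cite: AyyerLinussonRavichandran2025, §7 (p. 22)] -/
theorem pbC_good : ∀ (n : ℕ) {E₁ E₂ E C : Finset (Sym2 V)} {x y s t : V}, E₁.card ≤ n →
    IsTTSP E₁ x y → IsTTSP E₂ x y → Disjoint E₁ E₂ →
    (∀ z : V, (∃ e ∈ E₁, z ∈ e) → (∃ e ∈ E₂, z ∈ e) → z = x ∨ z = y) →
    E ⊆ E₁ ∪ E₂ → C ⊆ E₁ ∪ E₂ →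
    (∃ e ∈ E₁, s ∈ e) → (∃ e ∈ E₁, t ∈ e) →
    s ≠ x → s ≠ y → t ≠ x → t ≠ y → s ≠ t → SPGoodC E C x s t := by
  intro n
  induction n with
  | zero =>
    intro E₁ E₂ E C x y s t hcard h₁ _ _ _ _ _ _ _ _ _ _ _ _
    have := h₁.card_pos
    omega
  | succ n ih =>
    intro E₁ E₂ E C x y s t hcard h₁ h₂ hd hV hE hC hs ht hsx hsy htx hty hst
    cases h₁ with
    | edge hxy =>
      obtain ⟨e, he, hse⟩ := hs
      rw [Finset.mem_singleton] at he
      subst he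
      rcases Sym2.mem_iff.1 hse with h | h
      · exact absurd h hsx
      · exact absurd h hsy
    | @parallel Q₁ Q₂ _ _ hQ₁ hQ₂ hdQ hVQ =>
      have hlt1 := card_left_lt_of_parallel hQ₂ hdQ
      have hlt2 := card_right_lt_of_parallel hQ₁ hdQ
      obtain ⟨hP, hdP, hVP⟩ := reroot_par h₂ hd hV hQ₂ hdQ hVQ
      obtain ⟨hP', hdP', hVP'⟩ := reroot_par' h₂ hd hV hQ₁ hdQ hVQ
      have eA : Q₁ ∪ Q₂ ∪ E₂ = Q₁ ∪ (Q₂ ∪ E₂) := Finset.union_assoc _ _ _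
      have eB : Q₁ ∪ Q₂ ∪ E₂ = Q₂ ∪ (Q₁ ∪ E₂) := by ext e; simp only [Finset.mem_union]; tauto
      rcases span_union hs with hs1 | hs2 <;> rcases span_union ht with ht1 | ht2
      · exact ih (by omega) hQ₁ hP hdP hVP (eA ▸ hE) (eA ▸ hC) hs1 ht1 hsx hsy htx hty hst
      · have hr := spGoodC_corner hdP hVP hQ₁ hP (Finset.inter_subset_right (s₁ := E)) (Finset.inter_subset_right (s₁ := C))
          (Finset.inter_subset_right (s₁ := E)) (Finset.inter_subset_right (s₁ := C)) hs1
          ⟨ht2.choose, Finset.mem_union_left _ ht2.choose_spec.1, ht2.choose_spec.2⟩ hsx hsy htx hty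
        exact hr.congr_sets (inter_union2_eq hE eA) (inter_union2_eq hC eA)
      · have hr := spGoodC_corner hdP' hVP' hQ₂ hP' (Finset.inter_subset_right (s₁ := E)) (Finset.inter_subset_right (s₁ := C))
          (Finset.inter_subset_right (s₁ := E)) (Finset.inter_subset_right (s₁ := C)) hs2
          ⟨ht1.choose, Finset.mem_union_left _ ht1.choose_spec.1, ht1.choose_spec.2⟩ hsx hsy htx hty
        exact hr.congr_sets (inter_union2_eq hE eB) (inter_union2_eq hC eB)
      · exact ih (by omega) hQ₂ hP' hdP' hVP' (eB ▸ hE) (eB ▸ hC) hs2 ht2 hsx hsy htx hty hst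
    | @series F₁ F₂ _ m _ hF₁ hF₂ hdF hVF hxF₂ hyF₁ =>
      have hlt1 := card_left_lt_of_parallel hF₂ hdF
      have hlt2 := card_right_lt_of_parallel hF₁ hdF
      by_cases hsm : s = m
      · subst hsm
        exact pbC_junction h₂ hd hV hF₁ hF₂ hdF hVF hxF₂ hyF₁ hE hC ht (Ne.symm hst) htx
      by_cases htm : t = m
      · subst htm
        exact (pbC_junction h₂ hd hV hF₁ hF₂ hdF hVF hxF₂ hyF₁ hE hC hs hsm hsx).swap23
      obtain ⟨hA, hdA, hVA⟩ := reroot_serA h₂ hd hV hF₁ hF₂ hdF hVF hxF₂ hyF₁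
      have hVA' : ∀ z : V, (∃ e ∈ F₁, z ∈ e) → (∃ e ∈ F₂ ∪ E₂, z ∈ e) → z = x ∨ z = m :=
        fun z h1 h => (hVA z h1 h).symm
      obtain ⟨hB, hdB, hVB⟩ := reroot_serB h₂ hd hV hF₁ hF₂ hdF hVF hxF₂ hyF₁
      have eA : F₁ ∪ F₂ ∪ E₂ = F₁ ∪ (F₂ ∪ E₂) := Finset.union_assoc _ _ _
      have eB : F₁ ∪ F₂ ∪ E₂ = F₂ ∪ (F₁ ∪ E₂) := by ext e; simp only [Finset.mem_union]; tauto
      rcases span_union hs with hs1 | hs2 <;> rcases span_union ht with ht1 | ht2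
      · exact ih (by omega) hF₁ hA.symm hdA hVA' (eA ▸ hE) (eA ▸ hC) hs1 ht1 hsx hsm htx htm hst
      · have hr := spGoodC_corner hdA hVA' hF₁ hA.symm (Finset.inter_subset_right (s₁ := E)) (Finset.inter_subset_right (s₁ := C))
          (Finset.inter_subset_right (s₁ := E)) (Finset.inter_subset_right (s₁ := C)) hs1
          ⟨ht2.choose, Finset.mem_union_left _ ht2.choose_spec.1, ht2.choose_spec.2⟩ hsx hsm htx htm
        exact hr.congr_sets (inter_union2_eq hE eA) (inter_union2_eq hC eA)
      · have hr := spGoodC_corner hdA hVA' hF₁ hA.symm (Finset.inter_subset_right (s₁ := E)) (Finset.inter_subset_right (s₁ := C))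
          (Finset.inter_subset_right (s₁ := E)) (Finset.inter_subset_right (s₁ := C)) ht1
          ⟨hs2.choose, Finset.mem_union_left _ hs2.choose_spec.1, hs2.choose_spec.2⟩ htx htm hsx hsm
        exact hr.swap23.congr_sets (inter_union2_eq hE eA) (inter_union2_eq hC eA)
      · obtain ⟨ex, hex, hxex⟩ := hF₁.left_mem
        exact typeIC_good F₂.card le_rfl hF₂ hB hdB hVB (eB ▸ hE) (eB ▸ hC) hs2 ht2 ⟨ex, Finset.mem_union_left _ hex, hxex⟩
          hsm hsy htm hty hF₁.ne h₂.ne hst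

end OneTerminalC

end FK

end Summit.CriticalPhenomena.PercolationContinuityZ3.Theorems
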